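import Literature.MathematicalPhysics.StatisticalMechanics.CubicLatticeVoronoiFluctuations
import HarnessLib

/-!
# The edge-isoperimetric number of `ℤ^d` to second order:
# `EIP^d(N) = 2d N^{(d−1)/d} + O(N^{(d−2)/d})` (Cicalese–Leonardi 2020, (3.18)–(3.20))

Topic `Literature/MathematicalPhysics/StatisticalMechanics`; continues `GridEdgeIsoperimetry.lean`
(`eipValue d N = cubicleCost d N`, the Agnarsson–Lauria closed form of the edge-isoperimetric number of
`ℤ^d`, with the layer inequality `cubicleReal_all` and the slice monotonicity `cubicleMono_all`),
`Literature/Probability/LatticeModels/LoomisWhitney.lean` (the sharp discrete Loomis–Whitney inequality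
`2d |A|^{(d−1)/d} ≤ #Θ_d(A)`) and `CubicLatticeVoronoiFluctuations.lean` (the bridge to Cicalese–Leonardi's
continuum vocabulary, `cubicExcess (ι C) = #Θ_d(C)`).  Everything is PROVED; no definition and no named
fact is introduced.

## Source, as printed

M. Cicalese, G. P. Leonardi, *Maximal fluctuations on periodic lattices: an approach via quantitative
Wulff inequalities*, Comm. Math. Phys. **375** (2020) 1931–1944 [CicaleseLeonardi2020], §3.1 p. 6–7 (held
text `paper:doi-10-1007-s00220-019-03612-3`, p0006–p0007): with `E(X) = Σ_{x∈X} val(x,X)` on `ℤ^d` and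
`W_N = N^{1/d}[−½,½]^d`: "We clearly have `|ζ(X)| = #(X)` and `F(ζ(X)) = E_N(X)` whenever `X ∈ 𝒳_N`.
Moreover, (2.13) and (2.14) trivially hold with `β_N = 0` and `γ_N = inf_{Y∈𝒳} E_N(Y) − inf_{|D|=N} F(D)`
(3.18)" (p. 6), the denominator `2dN^{1−1/d} = P_1(W_N) = min_{|D|=N} P_1(D)` of (3.19) (the Wulff
inequality), and "Let `k ≥ 0` be the unique integer such that `k^d ≤ N < (k+1)^d`.  It is not difficult
to check that one can build a configuration `X_N`, such that `|ζ(X_N)| = N` and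
`E(X_N) ≤ 2d(k+1)^{d−1} ≤ 2dk^{d−1} + C_d k^{d−2}` … Hence we find `γ_N ≤ C_d N^{1−2/d}` (3.20)" (p. 7).
These displays are listed under WHAT IS NOT HERE in `LatticeMaximalFluctuations.lean` ("the intermediate
bounds (3.19)–(3.20) … on `γ_N`").

## Contents (namespace `Literature.MathematicalPhysics.StatisticalMechanics`)

* `cubicleCost_le_of_le_pow` — the integer form **`Φ_d(M) ≤ 2d K^{d−1} + 4^d K^{d−2}` for `M ≤ K^d`,
  `K ≥ 1`, `d ≥ 2`** (induction on `d`: `M = q K^{d−1} + r`, a stack of `q ≤ K` full `(d−1)`-cubes and one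
  partial layer, `cubicleReal_all`; our quasi-cube replaces the source's removal algorithm).
* `eipValue_le_rpow` — **`EIP^d(N) ≤ 2d N^{(d−1)/d} + C_d N^{(d−2)/d}`** (`d ≥ 2`), i.e. (3.20).
* `rpow_le_eipValue` — **`2d N^{(d−1)/d} ≤ EIP^d(N)`** (`N ≥ 1`), i.e. `γ_N ≥ 0` (the lattice side of
  the Wulff inequality `min_{|D|=N} P_1 = P_1(W_N) = 2dN^{(d−1)/d}` used in (3.19)).
* `abs_eipValue_sub_rpow_le` — **`|EIP^d(N) − 2d N^{(d−1)/d}| ≤ C_d N^{(d−2)/d}`**: the surface constant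
  of the cubic lattice is `2d` (the `ℓ¹`-perimeter of the unit cube), with an explicit second-order rate —
  the `ℤ^d` analogue of the surface constants `γ` of `StickyWulffConstants.lean`.
* In Cicalese–Leonardi's vocabulary: `CicaleseLeonardi2020.rpow_le_cubicExcess`
  (`E(X) ≥ 2d (#X)^{(d−1)/d}` for every nonempty `X ⊂ ℤ^d`) and
  `CicaleseLeonardi2020.exists_cubicExcess_le_rpow` (for every `N` some `N`-point `X ⊂ ℤ^d` has
  `E(X) ≤ 2d N^{(d−1)/d} + C_d N^{(d−2)/d}`, i.e. `γ_N ≤ C_d N^{1−2/d}`).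

WHAT IS NOT HERE: the identity `F(ζ(X)) = E_N(X)` (`P_1` of a union of lattice cubes = number of
boundary faces) for the tree's distributional anisotropic perimeter, and `min_{|D|=N} P_1(D) = 2dN^{(d−1)/d}`
on the continuum side; the value of the constant `C_d` of the source (ours is `2d·3^{d−1} + 4^d 2^{d−2}`
after the substitution `K = ⌊N^{1/d}⌋ + 1`, not optimised); `d = 1` (where `EIP^1(N) = 2`).

## References

* [CicaleseLeonardi2020] M. Cicalese, G. P. Leonardi, Comm. Math. Phys. 375 (2020) 1931–1944, §3.1
  (3.18)–(3.20), p. 6–7.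
* [AgnarssonLauria2013] G. Agnarsson, K. Lauria, *Extremal subsets of `{1,…,n}^d` / the grid graph*
  (the closed form `E_d = cubicleCost`, Theorem 6.4), as vendored in `GridCubicles.lean` /
  `GridEdgeIsoperimetry.lean`.
* [MaininiSchmidt2020] E. Mainini, B. Schmidt, Comm. Math. Phys. 380 (2020) 947–971, §1 (`EIP^d(n)`).
-/

noncomputable section

open Finset

namespace Literature.MathematicalPhysics.StatisticalMechanics

open Literature.Probability.LatticeModels
open Literature.Algebra.EuclideanLattices (intVec intVec_apply intVec_injective)

variable {d : ℕ}

/-! ### G1: the second-order upper bound for the cubicle cost, in `ℕ` -/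

/-- `Φ_1(M) ≤ 2` (`EIP^1` of an interval). [cite: AgnarssonLauria2013, §5 (d = 1); MaininiSchmidt2020, §1] -/
theorem cubicleCost_one_le (M : ℕ) : cubicleCost 1 M ≤ 2 := by
  rcases Nat.eq_zero_or_pos M with rfl | hM
  · rw [cubicleCost_zero]; exact Nat.zero_le _
  · rw [cubicleCost_one hM]

/-- **`Φ_d(M) ≤ 2d K^{d−1} + 4^d K^{d−2}` whenever `M ≤ K^d`, `K ≥ 1`** (`d = n + 2 ≥ 2`; `Φ_d =
cubicleCost d = EIP^d`).  Induction on `d`: write `M = q K^{d−1} + r` (`q ≤ K`, `r < K^{d−1}`); for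
`q ≥ 1` the layer inequality `cubicleReal_all` gives `Φ_d(M) ≤ 2K^{d−1} + q Φ_{d−1}(K^{d−1}) + Φ_{d−1}(r)`,
for `q = 0` the slice bound `cubicleMono_all` gives `Φ_d(M) ≤ 2M + Φ_{d−1}(M)`; base `d = 2` from
`Φ_1 ≤ 2`.  (The source's (3.20) is obtained instead by a removal algorithm from the cube of side `k+1`.)
[cite: CicaleseLeonardi2020, §3.1 (3.20) p. 7; AgnarssonLauria2013, §5–§6 (layer decomposition)] -/
theorem cubicleCost_le_of_le_pow (n : ℕ) : ∀ {K M : ℕ}, 1 ≤ K → M ≤ K ^ (n + 2) →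
    cubicleCost (n + 2) M ≤ 2 * (n + 2) * K ^ (n + 1) + 4 ^ (n + 2) * K ^ n := by
  induction n with
  | zero =>
    intro K M hK hM
    simp only [zero_add, pow_one, pow_zero, mul_one]
    have hdm := Nat.div_add_mod M K
    set q := M / K with hq
    set r := M % K with hr
    have hrK : r < K := Nat.mod_lt _ hK
    have hqK : q ≤ K := Nat.div_le_of_le_mul (by simpa [pow_two] using hM)
    have h1r := cubicleCost_one_le r
    rcases Nat.eq_zero_or_pos q with hq0 | hq1
    · -- `M = r < K`: one slice
      have hMr : M = r := by rw [hq0, mul_zero, zero_add] at hdm; exact hdm.symm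
      have hmono := cubicleMono_all 2 M
      have h1M := cubicleCost_one_le M
      norm_num at hmono
      omega
    · have key := cubicleReal_all 2 K q r hq1 hrK.le
      norm_num at key
      rw [cubicleCost_one hK] at key
      have hM' : M = q * K + r := by rw [mul_comm]; exact hdm.symm
      rw [hM']
      omega
  | succ n ih =>
    intro K M hK hM
    have hΔ1 : 1 ≤ K ^ (n + 2) := Nat.one_le_pow _ _ hK
    have hdm := Nat.div_add_mod M (K ^ (n + 2))
    set q := M / K ^ (n + 2) with hq
    set r := M % K ^ (n + 2) with hr
    have hrΔ : r < K ^ (n + 2) := Nat.mod_lt _ hΔ1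
    have hqK : q ≤ K := Nat.div_le_of_le_mul (by rw [← pow_succ]; exact hM)
    have ihΔ := ih hK (le_refl (K ^ (n + 2)))
    have ihr := ih hK hrΔ.le
    have hKn : K ^ n ≤ K ^ (n + 1) := Nat.pow_le_pow_right hK (by omega)
    have hKn1 : K ^ (n + 1) ≤ K ^ (n + 2) := Nat.pow_le_pow_right hK (by omega)
    have hsmall : n + 2 ≤ 4 ^ (n + 2) := (Nat.lt_pow_self (by norm_num)).le
    have e4 : 4 ^ (n + 1 + 2) = 4 * 4 ^ (n + 2) := by rw [pow_succ]; ring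
    have eK2 : K ^ (n + 1 + 1) = K ^ (n + 2) := rfl
    have eK3 : K * K ^ (n + 1) = K ^ (n + 2) := by rw [pow_succ]; ring
    have eK4 : K * K ^ n = K ^ (n + 1) := by rw [pow_succ]; ring
    have esub : n + 1 + 2 - 1 = n + 2 := by omega
    -- products used by `nlinarith`
    have p1 : 4 ^ (n + 2) * K ^ n ≤ 4 ^ (n + 2) * K ^ (n + 1) := Nat.mul_le_mul_left _ hKn
    have p2 : (n + 2) * K ^ (n + 1) ≤ 4 ^ (n + 2) * K ^ (n + 1) := Nat.mul_le_mul_right _ hsmall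
    have p3 : (n + 2) * K ^ (n + 1) ≤ (n + 2) * K ^ (n + 2) := Nat.mul_le_mul_left _ hKn1
    rw [e4, eK2]
    rcases Nat.eq_zero_or_pos q with hq0 | hq1
    · have hMr : M = r := by rw [hq0, mul_zero, zero_add] at hdm; exact hdm.symm
      have hMle : M ≤ K ^ (n + 2) := by rw [hMr]; exact hrΔ.le
      have hmono := cubicleMono_all (n + 1 + 2) M
      rw [esub] at hmono
      have ihM := ih hK hMle
      nlinarith [hmono, ihM, hMle, p1, p2, p3, hKn1]
    · have key := cubicleReal_all (n + 1 + 2) (K ^ (n + 2)) q r hq1 hrΔ.le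
      rw [esub] at key
      have hM' : M = q * K ^ (n + 2) + r := by rw [mul_comm]; exact hdm.symm
      have hqc : q * cubicleCost (n + 2) (K ^ (n + 2)) ≤
          K * (2 * (n + 2) * K ^ (n + 1) + 4 ^ (n + 2) * K ^ n) :=
        Nat.mul_le_mul hqK ihΔ
      have e1 : K * (2 * (n + 2) * K ^ (n + 1) + 4 ^ (n + 2) * K ^ n) =
          2 * (n + 2) * K ^ (n + 2) + 4 ^ (n + 2) * K ^ (n + 1) := by
        rw [← eK3, ← eK4]; ring
      rw [e1] at hqc
      rw [hM']
      nlinarith [key, hqc, ihr, p1, p2, p3]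


/-! ### G2: real-exponent form, the matching lower bound, and the continuum vocabulary -/

/-- `(k+1)^{j+1} ≤ k^{j+1} + 3^{j+1} k^j` for `k ≥ 1`. [folklore] -/
private theorem succ_pow_succ_le (k : ℕ) (hk : 1 ≤ k) :
    ∀ j : ℕ, (k + 1) ^ (j + 1) ≤ k ^ (j + 1) + 3 ^ (j + 1) * k ^ j
  | 0 => by simp
  | j + 1 => by
    have ih := succ_pow_succ_le k hk j
    have hkj : k ^ j ≤ k ^ (j + 1) := Nat.pow_le_pow_right hk (by omega)
    have p1 : 3 ^ (j + 1) * k ^ j ≤ 3 ^ (j + 1) * k ^ (j + 1) := Nat.mul_le_mul_left _ hkj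
    have p2 : k ^ (j + 1) ≤ 3 ^ (j + 1) * k ^ (j + 1) :=
      Nat.le_mul_of_pos_left _ (Nat.one_le_pow _ _ (by norm_num))
    have h := Nat.mul_le_mul_right (k + 1) ih
    have e : (k ^ (j + 1) + 3 ^ (j + 1) * k ^ j) * (k + 1) =
        k ^ (j + 1) * k + k ^ (j + 1) + 3 ^ (j + 1) * (k ^ j * k) + 3 ^ (j + 1) * k ^ j := by ring
    rw [e, ← pow_succ] at h
    calc (k + 1) ^ (j + 1 + 1) = (k + 1) ^ (j + 1) * (k + 1) := pow_succ _ _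
      _ ≤ k ^ (j + 1) * k + k ^ (j + 1) + 3 ^ (j + 1) * k ^ (j + 1) + 3 ^ (j + 1) * k ^ j := h
      _ ≤ k ^ (j + 1) * k + (3 ^ (j + 1) * k ^ (j + 1) + 3 ^ (j + 1) * k ^ (j + 1) +
          3 ^ (j + 1) * k ^ (j + 1)) := by linarith [p1, p2]
      _ = k ^ (j + 1 + 1) + 3 ^ (j + 1 + 1) * k ^ (j + 1) := by ring

/-- `k^e ≤ N^{e/d}` in `ℝ` when `k^d ≤ N` in `ℕ`. [folklore] -/
private theorem pow_le_rpow_div_of_pow_le {k N d : ℕ} (hd : d ≠ 0) (h : k ^ d ≤ N) (e : ℕ) :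
    (k : ℝ) ^ e ≤ (N : ℝ) ^ ((e : ℝ) / d) := by
  have hk : (0 : ℝ) ≤ k := Nat.cast_nonneg k
  have hdR : (d : ℝ) ≠ 0 := by exact_mod_cast hd
  have e1 : (((k : ℝ) ^ d) : ℝ) ^ ((e : ℝ) / d) = (k : ℝ) ^ e := by
    rw [← Real.rpow_natCast (k : ℝ) d, ← Real.rpow_mul hk, mul_div_cancel₀ _ hdR, Real.rpow_natCast]
  rw [← e1]
  exact Real.rpow_le_rpow (pow_nonneg hk _) (by exact_mod_cast h) (by positivity)

/-- **The edge-isoperimetric number of `ℤ^d` to second order — upper bound (PROVED)**: for `d ≥ 2`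
there is `C_d` with `EIP^d(N) ≤ 2d N^{(d−1)/d} + C_d N^{(d−2)/d}` for every `N` (quasi-cubes: a stack of
`(d−1)`-cubes plus one partial layer, recursively — the integer form is `cubicleCost_le_of_le_pow`).  This
is Cicalese–Leonardi's (3.19)–(3.20) "`γ_N ≤ C_d N^{1−2/d}`" (`γ_N = inf_X E_N(X) − P_1(W_N)`,
`P_1(W_N) = 2d N^{(d−1)/d}`), listed as not typed in `LatticeMaximalFluctuations.lean`.
[cite: CicaleseLeonardi2020, §3.1 (3.19)–(3.20) p. 6–7; AgnarssonLauria2013, Theorem 6.4 (E_d = cubicleCost)] -/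
theorem eipValue_le_rpow (hd : 2 ≤ d) : ∃ C : ℝ, 0 < C ∧ ∀ N : ℕ,
    (eipValue d N : ℝ) ≤ 2 * d * (N : ℝ) ^ (((d : ℝ) - 1) / d) + C * (N : ℝ) ^ (((d : ℝ) - 2) / d) := by
  obtain ⟨n, rfl⟩ : ∃ n, d = n + 2 := ⟨d - 2, by omega⟩
  refine ⟨2 * (n + 2) * 3 ^ (n + 1) + 4 ^ (n + 2) * 2 ^ n, by positivity, fun N => ?_⟩
  have hexp1 : (((n + 2 : ℕ) : ℝ) - 1) / ((n + 2 : ℕ) : ℝ) = ((n + 1 : ℕ) : ℝ) / ((n + 2 : ℕ) : ℝ) := by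
    push_cast; ring
  have hexp2 : (((n + 2 : ℕ) : ℝ) - 2) / ((n + 2 : ℕ) : ℝ) = ((n : ℕ) : ℝ) / ((n + 2 : ℕ) : ℝ) := by
    push_cast; ring
  rw [hexp1, hexp2]
  rcases Nat.eq_zero_or_pos N with rfl | hN
  · rw [eipValue_zero_right]; push_cast; positivity
  set k := iroot (n + 2) N with hk
  have hk1 : 1 ≤ k := iroot_pos (by omega) hN
  have hkN : k ^ (n + 2) ≤ N := iroot_pow_le (by omega) N
  have hNk : N < (k + 1) ^ (n + 2) := lt_succ_iroot_pow (by omega) N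
  have hnat := cubicleCost_le_of_le_pow n (K := k + 1) (by omega) hNk.le
  have hq := succ_pow_succ_le k hk1 n
  have h2 : (k + 1) ^ n ≤ 2 ^ n * k ^ n := by
    rw [← mul_pow]; exact Nat.pow_le_pow_left (by omega) n
  have hnat' : cubicleCost (n + 2) N ≤
      2 * (n + 2) * k ^ (n + 1) + (2 * (n + 2) * 3 ^ (n + 1) + 4 ^ (n + 2) * 2 ^ n) * k ^ n := by
    nlinarith [hnat, hq, h2, Nat.mul_le_mul_left (2 * (n + 2)) hq, Nat.mul_le_mul_left (4 ^ (n + 2)) h2]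
  rw [eipValue_eq_cubicleCost (by omega)]
  have hk1R := pow_le_rpow_div_of_pow_le (by omega : n + 2 ≠ 0) hkN (n + 1)
  have hk2R := pow_le_rpow_div_of_pow_le (by omega : n + 2 ≠ 0) hkN n
  have hcast : (cubicleCost (n + 2) N : ℝ) ≤
      2 * (n + 2) * (k : ℝ) ^ (n + 1) + (2 * (n + 2) * 3 ^ (n + 1) + 4 ^ (n + 2) * 2 ^ n) * (k : ℝ) ^ n := by
    exact_mod_cast hnat'
  refine hcast.trans ?_
  push_cast at hk1R hk2R ⊢
  have hA : (0 : ℝ) ≤ 2 * ((n : ℝ) + 2) := by positivity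
  have hB : (0 : ℝ) ≤ 2 * ((n : ℝ) + 2) * 3 ^ (n + 1) + 4 ^ (n + 2) * 2 ^ n := by positivity
  have m1 := mul_le_mul_of_nonneg_left hk1R hA
  have m2 := mul_le_mul_of_nonneg_left hk2R hB
  linarith [m1, m2]

/-- **The matching lower bound** `2d N^{(d−1)/d} ≤ EIP^d(N)` (`N ≥ 1`) — the sharp discrete
Loomis–Whitney inequality of the tree (`two_mul_card_mul_rpow_le_card_boundaryPairs`) at a minimizer; in
Cicalese–Leonardi's terms `γ_N ≥ 0`, i.e. `inf_X E_N(X) ≥ P_1(W_N) = 2dN^{1−1/d}` ((3.18) with the Wulff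
inequality behind (3.19)). [cite: CicaleseLeonardi2020, §3.1 (3.18)–(3.19) p. 6–7; MaininiSchmidt2020, §1 (EIP^d(n))] -/
theorem rpow_le_eipValue (hd : 1 ≤ d) {N : ℕ} (hN : 1 ≤ N) :
    2 * d * (N : ℝ) ^ (((d : ℝ) - 1) / d) ≤ eipValue d N := by
  obtain ⟨n, rfl⟩ : ∃ n, d = n + 1 := ⟨d - 1, by omega⟩
  obtain ⟨A, hA, hAN⟩ := exists_isEIPMinimizer_card_eq n N
  have hne : A.Nonempty := card_pos.1 (by omega)
  have h := two_mul_card_mul_rpow_le_card_boundaryPairs (by omega) A hne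
  rw [hA.card_boundaryPairs_eq hAN, hAN] at h
  exact h

/-- **`EIP^d(N) = 2d N^{(d−1)/d} + O(N^{(d−2)/d})` (PROVED)**: the edge-isoperimetric number of the
cubic lattice to second order, for every `d ≥ 2` — the leading constant `2d` is the perimeter of the
unit cube, the Wulff shape of the `ℓ¹`-anisotropic perimeter (`P_1(W_N) = 2d N^{(d−1)/d}`, the analogue
for `ℤ^d` of the surface constants `γ` of `StickyWulffConstants.lean`).
[cite: CicaleseLeonardi2020, §3.1 (3.18)–(3.20) p. 6–7] -/
theorem abs_eipValue_sub_rpow_le (hd : 2 ≤ d) : ∃ C : ℝ, 0 < C ∧ ∀ N : ℕ,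
    |(eipValue d N : ℝ) - 2 * d * (N : ℝ) ^ (((d : ℝ) - 1) / d)| ≤ C * (N : ℝ) ^ (((d : ℝ) - 2) / d) := by
  obtain ⟨C, hC, hup⟩ := eipValue_le_rpow hd
  refine ⟨C, hC, fun N => ?_⟩
  have hnn : 0 ≤ C * (N : ℝ) ^ (((d : ℝ) - 2) / d) := by positivity
  rcases Nat.eq_zero_or_pos N with rfl | hN
  · have hθ : ((d : ℝ) - 1) / d ≠ 0 := by
      have : (2 : ℝ) ≤ d := by exact_mod_cast hd
      exact div_ne_zero (by linarith) (by linarith)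
    rw [eipValue_zero_right, Nat.cast_zero, Real.zero_rpow hθ, mul_zero, sub_zero, abs_zero]
    positivity
  rw [abs_sub_le_iff]
  exact ⟨by linarith [hup N], by linarith [rpow_le_eipValue (by omega : 1 ≤ d) hN]⟩

/-- **Cicalese–Leonardi's excess energy on `ℤ^d` obeys the Wulff lower bound** `E(X) ≥ 2d (#X)^{(d−1)/d}`
(`= P_1(W_{#X})`) for every nonempty finite `X ⊂ ℤ^d` (in the source: `E_N(X) = F(ζ(X)) ≥ min_{|D|=N} P_1
= 2dN^{1−1/d}`, p. 6–7), here from the discrete Loomis–Whitney inequality.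
[cite: CicaleseLeonardi2020, §3.1 (3.18)–(3.19) p. 6–7] -/
theorem CicaleseLeonardi2020.rpow_le_cubicExcess (hd : 1 ≤ d) {X : Finset (EuclideanSpace ℝ (Fin d))}
    (hX : (↑X : Set (EuclideanSpace ℝ (Fin d))) ⊆ CicaleseLeonardi2020.cubicLattice d) (hne : X.Nonempty) :
    2 * d * (X.card : ℝ) ^ (((d : ℝ) - 1) / d) ≤ CicaleseLeonardi2020.cubicExcess X := by
  classical
  obtain ⟨C, rfl⟩ := CicaleseLeonardi2020.exists_eq_image_intVec hX
  have hCne : C.Nonempty := by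
    obtain ⟨x, hx⟩ := hne
    obtain ⟨c, hc, -⟩ := mem_image.1 hx
    exact ⟨c, hc⟩
  rw [CicaleseLeonardi2020.cubicExcess_image_intVec, card_image_of_injective _ (intVec_injective d)]
  exact two_mul_card_mul_rpow_le_card_boundaryPairs hd C hCne

/-- **Cicalese–Leonardi 2020, (3.19)–(3.20): `γ_N ≤ C_d N^{1−2/d}` (PROVED)** — for every `d ≥ 2` there is
`C_d` such that for every `N` some `N`-point `X ⊂ ℤ^d` has `E(X) ≤ 2d N^{(d−1)/d} + C_d N^{(d−2)/d}`
(so `inf_{X ∈ 𝒳_N} E_N(X) − P_1(W_N) ≤ C_d N^{1−2/d}` with `P_1(W_N) = 2d N^{(d−1)/d}`).  The source's removal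
algorithm from the cube of side `k + 1` is replaced by the quasi-cube bound `eipValue_le_rpow`.
[cite: CicaleseLeonardi2020, §3.1 (3.19)–(3.20) p. 6–7] -/
theorem CicaleseLeonardi2020.exists_cubicExcess_le_rpow (hd : 2 ≤ d) : ∃ C : ℝ, 0 < C ∧ ∀ N : ℕ,
    ∃ X : Finset (EuclideanSpace ℝ (Fin d)),
      (↑X : Set (EuclideanSpace ℝ (Fin d))) ⊆ CicaleseLeonardi2020.cubicLattice d ∧ X.card = N ∧
        (CicaleseLeonardi2020.cubicExcess X : ℝ) ≤
          2 * d * (N : ℝ) ^ (((d : ℝ) - 1) / d) + C * (N : ℝ) ^ (((d : ℝ) - 2) / d) := by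
  classical
  obtain ⟨C, hC, hup⟩ := eipValue_le_rpow hd
  obtain ⟨n, rfl⟩ : ∃ n, d = n + 1 := ⟨d - 1, by omega⟩
  refine ⟨C, hC, fun N => ?_⟩
  obtain ⟨A, hA, hAN⟩ := exists_isEIPMinimizer_card_eq n N
  refine ⟨A.image (intVec (n + 1)), CicaleseLeonardi2020.coe_image_intVec_subset A,
    by rw [card_image_of_injective _ (intVec_injective (n + 1)), hAN], ?_⟩
  rw [CicaleseLeonardi2020.cubicExcess_image_intVec, hA.card_boundaryPairs_eq hAN]
  exact hup N

end Literature.MathematicalPhysics.StatisticalMechanics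

end
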